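import Summits.HodgeConjecture.HodgeConjecture.Theorems.MarkmanPartnerTransportSqrtTwoPartnerDescent
import Summits.HodgeConjecture.HodgeConjecture.Theorems.MarkmanPartnerTransportPartnerTransport
import Summits.HodgeConjecture.HodgeConjecture.Theorems.MarkmanPartnerTransportPicardThreeK3SquaresPicardTwelveSqrtTwo

/-!
# Route MarkmanPartnerTransport · cruxes #4 `PicardThreeK3Squares` (stmt-HodgeConjecture-19652) ∕ #5
# `LowPicardRealMultiplication` — «√2-PARTNERED-HK», file 2∕2: the Hodge conjecture for PARTNERED
# `K3^{[2]}`-type fourfolds with real multiplication by `√2`, modulo named facts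

Cell hodge-nonav, task T-P1AT-11a (planner p1 g48 ASSIGN 2026-08-29T10:18Z, memo ROUTE-P1AT §11.4; arbitration
p3 g36 10:41Z); prover seat hodge-nonav-20241-p1 (gen 21). `--supports stmt-HodgeConjecture-19652` helper (leaf:
imports the route file through `…PartnerTransport`); pure assembly of landed theorems; no definition, no sorry,
no new named fact; credits nothing — HC stays open.

The K3 side is a tree theorem: `NikulinIsogeny.hodgeConjectureFor_square_of_twelve_le_of_sqrtTwo`
(`…PicardTwelveSqrtTwo`) — HC⁴(S ⊗ S) for every marked projective K3 surface `S` with `ρ(S) ≥ 12` whose `H²`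
carries a rational Hodge endomorphism `ψ` with `ψ² = 2` and multiplier `2` on `T(S)` — and
`NikulinIsogeny.hodgeConjectureFor_square_of_eleven_le_of_sqrtTwo` (`ρ(S) ≥ 11` plus the sector clause
`End_Hdg(T(S)) ⊆ ℚ + ℚψ`). File 1∕2 (`…SqrtTwoPartnerDescent`) descends an `X`-side `√2`-datum `Θ` to such a
`ψ` along a K3 partner `(S, η, p, x, g)` ((g1), (g2), (g5)) and gives `ρ(X) ≤ ρ(S) + 1`; here:

* **`hodgeConjectureFor_of_partner_of_sqrtTwo_of_thirteen_le`** — **HC⁴(X) for every marked smooth projective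
  `K3^{[2]}`-type `X` with `ρ(X) ≥ 13`, a K3 partner and an `X`-side `√2`-datum `Θ`** (rational,
  type-preserving, `T_q(X)`-stable, `Θ² = 2` and multiplier `2` on `T_q(X)`): `ρ(S) ≥ 12`, descend `Θ ↦ ψ`,
  `…twelve_le_of_sqrtTwo` gives HC⁴(S ⊗ S), `partnerTransport_explicit` gives HC⁴(X);
* **`hodgeConjectureFor_of_partner_of_sqrtTwo_of_twelve_le`** — the same at **`ρ(X) ≥ 12` with the sector
  clause `End_Hdg(T(X)) ⊆ ℚ + ℚΘ`** (via `…eleven_le_of_sqrtTwo`);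
* `hodgeConjectureFor_of_partner_of_selfAdjoint_sqrtTwo_of_thirteen_le` — the `q`-SELF-ADJOINT form of the
  datum (`Θ` rational, type-preserving, `q`-self-adjoint, `Θ² = 2` on `T_q(X)`; `T_q`-stability and the
  multiplier follow), the shape of `Θ = u^* + (u^*)⁻¹` for an automorphism `u` with `u⁴ = −1` on `T(X)`
  (memo ROUTE-P1AT §11.4: the `u₈` cell of the cubic-fourfold automorphism families, `ρ(F) = 15`).

So «HC⁴ for partnered `K3^{[2]}`-type fourfolds with `ρ ≥ 13` (resp. `ρ ≥ 12` + sector clause) and real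
multiplication by `ℚ(√2)`» is a BY-NAME tree theorem, CONDITIONAL on {`Beauville1983_hilbertSquare_markedIncidence`,
`Beauville1983_hilbertSquare_blowupDiagonal_surjection`, `Markman2024_rationalHodgeIsometry_lift_algebraic_marked`,
`Voisin2003_cupProduct_algebraicClasses`} ∪ {`Buskin2019_hodgeIsometry_algebraic`, `Huybrechts_K3_marking_exists`
(thirteen forms only), `Huybrechts_K3_periodSurjective_projective`,
`Varesco2023_sqrtMultiplication_algebraic_of_symplecticAutomorphism`, `VanGeemenSarti2007_nikulinInvolution_of_primitiveE8`}.
The geometric instances (Fano varieties of lines of cubic fourfolds with a `ℚ(√2)`-RM automorphism, T-P1AT-11b)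
need a `FanoVarietyOfLines` notion and a Beauville–Donagi fact and are NOT part of this file. Nothing here
proves HC, HC_CM or HC_AV; rung-leaf assembly only.

References: M. Varesco, Math. Z. 305 (2023) Thm. 2.1, Prop. 2.5, Thm. 2.9, Rem. 2.10; B. van Geemen, A. Sarti,
Math. Z. 255 (2007) Prop. 2.3; N. Buskin, J. reine angew. Math. 755 (2019) Thm. 1.1; E. Markman, Compos. Math.
160 (2024) Thm. 1.1, Thm. 1.4; A. Beauville, J. Differential Geom. 18 (1983) §6 Prop. 6; D. Huybrechts,
*Lectures on K3 Surfaces* Ch. 3 Lemma 3.1.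
-/

noncomputable section

set_option linter.dupNamespace false

open scoped Matrix
open Module CategoryTheory MonoidalCategory
open Literature.AlgebraicTopology.SingularHomology Literature.Geometry.Kaehler
open Literature.AlgebraicGeometry Literature.AlgebraicGeometry.Motives Literature.AlgebraicGeometry.HodgeTheory
open Literature.AlgebraicGeometry.Hyperkaehler Literature.AlgebraicGeometry.Surfaces
open Literature.AlgebraicGeometry.HilbertScheme
open Summit.HodgeConjecture.HodgeConjecture.Theorems.NikulinTwinTransport
open Summit.HodgeConjecture.HodgeConjecture.Theorems.MarkmanPartnerTransport.BBFPositivity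

namespace Summit.HodgeConjecture.HodgeConjecture.Theorems.MarkmanPartnerTransport.PartnerLattice

/-- `MarkedK3Sq[X, φ, P, z]`: VERBATIM the `let MarkedK3Sq := …` binder of the route declarations of
MarkmanPartnerTransport (clauses (m1)–(m6)). Local notation only. -/
local notation3 (prettyPrint := false) "MarkedK3Sq[" X ", " φ ", " P ", " z "]" =>
  (((IsIntegralClass P ∧ ∀ Q : complexBetti X (2 * 4), IsIntegralClass Q → ∃ n : ℤ, Q = n • P) ∧
    (∀ c : complexBetti X 2, IsIntegralClass c ↔ ∃ v : K3HilbertIndex → ℤ, φ c = fun i => (v i : ℂ)) ∧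
    (∀ a : complexBetti X 2, cupPowTwo a 4 = ((3 : ℂ) * (k3HilbertForm 2 (φ a) (φ a)) ^ 2) • P) ∧
    (IsOfHodgeType 4 X 2 2 0 (LinearEquiv.symm φ z) ∧
      ∀ τ : complexBetti X 2, IsOfHodgeType 4 X 2 2 0 τ → ∃ t : ℂ, τ = t • LinearEquiv.symm φ z) ∧
    (∀ c : complexBetti X 2, IsOfHodgeType 4 X 2 1 1 c ↔
      (k3HilbertForm 2 (φ c) z = 0 ∧ k3HilbertForm 2 (φ c) (star z) = 0)) ∧
    (k3HilbertForm 2 z z = 0 ∧ 0 < (k3HilbertForm 2 (star z) z).re)))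

/-- `MarkedK3[S, η, p, x]`: VERBATIM the `let MarkedK3 := …` binder of the route declarations (`p ≠ 0`, the six
marking clauses, the projective period point). Local notation only. -/
local notation3 (prettyPrint := false) "MarkedK3[" S ", " η ", " p ", " x "]" =>
  (p ≠ 0 ∧ (IsIntegralClass p ∧
    (∀ q : complexBetti S (2 * 2), IsIntegralClass q → ∃ n : ℤ, q = n • p) ∧
    (∀ c : complexBetti S (2 * 1), IsIntegralClass c ↔ ∃ v : K3Index → ℤ, η c = fun i => (v i : ℂ)) ∧
    (∀ a b : complexBetti S (2 * 1),
      cupProduct (rfl : 2 * 1 + 2 * 1 = 2 * 2) a b = k3Form (η a) (η b) • p) ∧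
    IsOfHodgeType 2 S (2 * 1) 2 0 (LinearEquiv.symm η x) ∧
    (∀ τ : complexBetti S (2 * 1), IsOfHodgeType 2 S (2 * 1) 2 0 τ →
      ∃ t : ℂ, τ = t • LinearEquiv.symm η x)) ∧
    (k3Form x x = 0 ∧ 0 < (k3Form (star x) x).re ∧
      ∃ u : K3Index → ℤ, k3Form (fun i => (u i : ℂ)) x = 0 ∧ 0 < ∑ i, ∑ j, u i * k3Gram i j * u j))

/-- `Partner[X, φ, S, η, g]`: clauses (g1), (g2), (g5) of the route's `IsK3Partner` datum — `g : H²(S) → H²(X)`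
rational, type-preserving, isometric on cup-transcendental classes (the clauses `partnerTransport_explicit` uses).
Local notation only. -/
local notation3 (prettyPrint := false) "Partner[" X ", " φ ", " S ", " η ", " g "]" =>
  ((∀ a, IsRationalClass a → IsRationalClass (g a)) ∧
    (∀ (i j : ℕ) a, IsOfHodgeType 2 S (2 * 1) i j a → IsOfHodgeType 4 X 2 i j (g a)) ∧
    (∀ a b, (∀ d ∈ algebraicClasses S 1, cupProduct (rfl : 2 * 1 + 2 * 1 = 2 * 2) a d = 0) →
      (∀ d ∈ algebraicClasses S 1, cupProduct (rfl : 2 * 1 + 2 * 1 = 2 * 2) b d = 0) →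
      k3HilbertForm 2 (φ (g a)) (φ (g b)) = k3Form (η a) (η b)))

/-- `SqrtTwoX[X, φ, Θ]` (VERBATIM `…SqrtTwoPartnerDescent`): the `X`-side `√2`-datum — `Θ` rational,
type-preserving, `T_q(X)`-stable, `Θ² = 2` and multiplier `2` on `T_q(X) = N¹(X)^{⊥_q}`. Local notation only. -/
local notation3 (prettyPrint := false) "SqrtTwoX[" X ", " φ ", " Θ "]" =>
  ((∀ y, IsRationalClass y → IsRationalClass (Θ y)) ∧
    (∀ (i j : ℕ) y, IsOfHodgeType 4 X 2 i j y → IsOfHodgeType 4 X 2 i j (Θ y)) ∧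
    (∀ y : complexBetti X 2,
      (∀ d : complexBetti X 2, d ∈ algebraicClasses X 1 → k3HilbertForm 2 (φ y) (φ d) = 0) →
      ∀ d : complexBetti X 2, d ∈ algebraicClasses X 1 → k3HilbertForm 2 (φ (Θ y)) (φ d) = 0) ∧
    (∀ y : complexBetti X 2,
      (∀ d : complexBetti X 2, d ∈ algebraicClasses X 1 → k3HilbertForm 2 (φ y) (φ d) = 0) →
      Θ (Θ y) = (2 : ℂ) • y) ∧
    (∀ y : complexBetti X 2,
      (∀ d : complexBetti X 2, d ∈ algebraicClasses X 1 → k3HilbertForm 2 (φ y) (φ d) = 0) →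
      ∀ w : complexBetti X 2,
        (∀ d : complexBetti X 2, d ∈ algebraicClasses X 1 → k3HilbertForm 2 (φ w) (φ d) = 0) →
        k3HilbertForm 2 (φ (Θ y)) (φ (Θ w)) = (2 : ℂ) * k3HilbertForm 2 (φ y) (φ w)))

/-- `SectorX[X, φ, Θ]` (VERBATIM `…SqrtTwoPartnerDescent`): the `X`-side sector clause
`End_Hdg(T(X)) ⊆ ℚ + ℚΘ`. Local notation only. -/
local notation3 (prettyPrint := false) "SectorX[" X ", " φ ", " Θ "]" =>
  (∀ f : complexBetti X 2 →ₗ[ℂ] complexBetti X 2,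
    (∀ y, IsRationalClass y → IsRationalClass (f y)) →
    (∀ (i j : ℕ) y, IsOfHodgeType 4 X 2 i j y → IsOfHodgeType 4 X 2 i j (f y)) →
    (∀ d : complexBetti X 2, d ∈ algebraicClasses X 1 → f d = 0) →
    (∀ y : complexBetti X 2, ∀ d : complexBetti X 2, d ∈ algebraicClasses X 1 →
      k3HilbertForm 2 (φ (f y)) (φ d) = 0) →
    ∃ a b : ℚ, ∀ y : complexBetti X 2,
      (∀ d : complexBetti X 2, d ∈ algebraicClasses X 1 → k3HilbertForm 2 (φ y) (φ d) = 0) →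
      f y = (a : ℂ) • y + (b : ℂ) • Θ y)

variable {X S : SchemeOver ℂ} {φ : complexBetti X 2 ≃ₗ[ℂ] (K3HilbertIndex → ℂ)} {P : complexBetti X (2 * 4)}
  {z : K3HilbertIndex → ℂ} {η : complexBetti S (2 * 1) ≃ₗ[ℂ] (K3Index → ℂ)} {p : complexBetti S (2 * 2)}
  {x : K3Index → ℂ}

/-! ### The cell theorems -/

/-- **«√2-PARTNERED-HK» at `ρ(X) ≥ 13`: the Hodge conjecture for every marked smooth projective
`K3^{[2]}`-type fourfold `X` with `ρ(X) ≥ 13`, a K3 partner `(S, η, p, x, g)` ((g1), (g2), (g5)) and an `X`-side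
`√2`-datum `Θ` (rational, type-preserving, `T_q(X)`-stable, `Θ² = 2` and multiplier `2` on `T_q(X)`)**, modulo
the nine displayed named facts: `ρ(S) ≥ ρ(X) − 1 ≥ 12` (`finrank_algebraicClasses_le_partner_succ_of_partner`),
`Θ` descends to `ψ` on `H²(S)` (`exists_sqrtTwo_descent_of_partner`),
`NikulinIsogeny.hodgeConjectureFor_square_of_twelve_le_of_sqrtTwo` gives HC⁴(S ⊗ S), and
`partnerTransport_explicit` carries it to HC⁴(X). E.g. every partnered `ℚ(√2)`-RM cell with
`ρ(X) ∈ {13, 15, 17}`. [cite: Varesco2023, Thm. 2.1, Prop. 2.5 and Thm. 2.9] [cite: Markman2024, Thm. 1.1 and 1.4]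
[cite: Beauville1983, §6 Prop. 6] [cite: Buskin2019, Thm. 1.1] -/
theorem hodgeConjectureFor_of_partner_of_sqrtTwo_of_thirteen_le
    (hBI : Beauville1983_hilbertSquare_markedIncidence)
    (hBD : Beauville1983_hilbertSquare_blowupDiagonal_surjection)
    (hMk : Markman2024_rationalHodgeIsometry_lift_algebraic_marked)
    (hcup : Voisin2003_cupProduct_algebraicClasses)
    (hB : Buskin2019_hodgeIsometry_algebraic) (hmark : Huybrechts_K3_marking_exists)
    (hPS : Huybrechts_K3_periodSurjective_projective)
    (hV : Varesco2023_sqrtMultiplication_algebraic_of_symplecticAutomorphism)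
    (hGS : VanGeemenSarti2007_nikulinInvolution_of_primitiveE8)
    (hX : IsSmoothProjective 4 X) (hK : IsOfK3HilbertSquareType X) (hM : MarkedK3Sq[X, φ, P, z])
    (hρ : 13 ≤ Module.finrank ℂ ↥(algebraicClasses X 1))
    (hS : IsK3Surface S) (hMS : MarkedK3[S, η, p, x])
    {g : complexBetti S (2 * 1) →ₗ[ℂ] complexBetti X 2} (hg : Partner[X, φ, S, η, g])
    {Θ : complexBetti X 2 →ₗ[ℂ] complexBetti X 2} (hΘ : SqrtTwoX[X, φ, Θ]) :
    HodgeConjectureFor 4 X := by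
  obtain ⟨hp0, hmk, hxx, hxpos, hu⟩ := hMS
  obtain ⟨hg1, hg2, hg5⟩ := hg
  have hμ := hasPoincareDuality_complexOrientationFamily
  obtain ⟨H, hH, Ξ, φH, PH, -, -, hMH, θ, hθ, hi⟩ := hBI complexOrientationFamily hμ S hS η p x hmk hxx hxpos hu
  obtain ⟨-, -, hηint, hcupS, h20, h20span⟩ := id hmk
  -- `ρ(S) ≥ 12`
  have hle := finrank_algebraicClasses_le_partner_succ_of_partner hcup hμ hX hM hS hp0 hηint hcupS h20 hxpos hH
    hMH hθ hi hg1 hg2 hg5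
  have hρS : 12 ≤ Module.finrank ℂ ↥(algebraicClasses S 1) := by omega
  -- descend the `√2`-datum and run the K3-side theorem
  obtain ⟨ψ, hψrat, hψtyp, -, hψsq, hψmul, -⟩ := exists_sqrtTwo_descent_of_partner hcup hμ hX hM hS hp0 hηint
    hcupS h20 h20span hxpos hH hMH hθ hi hg1 hg2 hg5 hΘ
  have hHC : HodgeConjectureFor 4 (S ⊗ S) :=
    NikulinIsogeny.hodgeConjectureFor_square_of_twelve_le_of_sqrtTwo hB hmark hPS hV hGS hS η p x
      ⟨hp0, hmk, hxx, hxpos, hu⟩ hρS ψ hψrat hψtyp hψsq hψmul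
  -- partner transport
  exact partnerTransport_explicit hBI hBD hMk hcup hX hK hM hS hmk hxx hxpos hu hg1 hg2 hg5 hHC

/-- **«√2-PARTNERED-HK» at `ρ(X) ≥ 12` with the sector clause: the Hodge conjecture for every marked smooth
projective `K3^{[2]}`-type fourfold `X` with `ρ(X) ≥ 12`, a K3 partner `(S, η, p, x, g)`, an `X`-side
`√2`-datum `Θ` and `End_Hdg(T(X)) ⊆ ℚ + ℚΘ`**, modulo the eight displayed named facts: `ρ(S) ≥ 11`, the datum
AND the sector clause descend (`exists_sqrtTwo_descent_of_partner`),
`NikulinIsogeny.hodgeConjectureFor_square_of_eleven_le_of_sqrtTwo` gives HC⁴(S ⊗ S), and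
`partnerTransport_explicit` gives HC⁴(X). E.g. every partnered `ℚ(√2)`-RM cell with `ρ(X) ∈ {13, 15, 17}` whose
`End_Hdg(T(X))` is exactly `ℚ(√2)`. [cite: Varesco2023, Thm. 2.1, Prop. 2.5, Thm. 2.9 and Rem. 2.10]
[cite: VanGeemenSarti2007, Prop. 2.3] [cite: Markman2024, Thm. 1.1 and 1.4] [cite: Beauville1983, §6 Prop. 6] -/
theorem hodgeConjectureFor_of_partner_of_sqrtTwo_of_twelve_le
    (hBI : Beauville1983_hilbertSquare_markedIncidence)
    (hBD : Beauville1983_hilbertSquare_blowupDiagonal_surjection)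
    (hMk : Markman2024_rationalHodgeIsometry_lift_algebraic_marked)
    (hcup : Voisin2003_cupProduct_algebraicClasses)
    (hB : Buskin2019_hodgeIsometry_algebraic) (hPS : Huybrechts_K3_periodSurjective_projective)
    (hV : Varesco2023_sqrtMultiplication_algebraic_of_symplecticAutomorphism)
    (hGS : VanGeemenSarti2007_nikulinInvolution_of_primitiveE8)
    (hX : IsSmoothProjective 4 X) (hK : IsOfK3HilbertSquareType X) (hM : MarkedK3Sq[X, φ, P, z])
    (hρ : 12 ≤ Module.finrank ℂ ↥(algebraicClasses X 1))
    (hS : IsK3Surface S) (hMS : MarkedK3[S, η, p, x])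
    {g : complexBetti S (2 * 1) →ₗ[ℂ] complexBetti X 2} (hg : Partner[X, φ, S, η, g])
    {Θ : complexBetti X 2 →ₗ[ℂ] complexBetti X 2} (hΘ : SqrtTwoX[X, φ, Θ]) (hU : SectorX[X, φ, Θ]) :
    HodgeConjectureFor 4 X := by
  obtain ⟨hp0, hmk, hxx, hxpos, hu⟩ := hMS
  obtain ⟨hg1, hg2, hg5⟩ := hg
  have hμ := hasPoincareDuality_complexOrientationFamily
  obtain ⟨H, hH, Ξ, φH, PH, -, -, hMH, θ, hθ, hi⟩ := hBI complexOrientationFamily hμ S hS η p x hmk hxx hxpos hu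
  obtain ⟨-, -, hηint, hcupS, h20, h20span⟩ := id hmk
  -- `ρ(S) ≥ 11`
  have hle := finrank_algebraicClasses_le_partner_succ_of_partner hcup hμ hX hM hS hp0 hηint hcupS h20 hxpos hH
    hMH hθ hi hg1 hg2 hg5
  have hρS : 11 ≤ Module.finrank ℂ ↥(algebraicClasses S 1) := by omega
  -- descend the `√2`-datum with its sector clause and run the K3-side theorem
  obtain ⟨ψ, hψrat, hψtyp, hψT, hψsq, hψmul, hψU⟩ := exists_sqrtTwo_descent_of_partner hcup hμ hX hM hS hp0
    hηint hcupS h20 h20span hxpos hH hMH hθ hi hg1 hg2 hg5 hΘ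
  have hHC : HodgeConjectureFor 4 (S ⊗ S) :=
    NikulinIsogeny.hodgeConjectureFor_square_of_eleven_le_of_sqrtTwo hB hPS hV hGS hS η p x
      ⟨hp0, hmk, hxx, hxpos, hu⟩ hρS ψ
      ⟨hψT, fun y _ hy => hψrat y hy, fun i j y _ hy => hψtyp i j y hy, hψsq, hψmul, hψU hU⟩
  -- partner transport
  exact partnerTransport_explicit hBI hBD hMk hcup hX hK hM hS hmk hxx hxpos hu hg1 hg2 hg5 hHC

/-- **The `q`-self-adjoint form** (the shape of `Θ = u^* + (u^*)⁻¹` for an automorphism `u` of `X` whose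
eigenvalues on `T(X)` are primitive `8`-th roots of unity, memo ROUTE-P1AT §11.4): for a marked smooth
projective `K3^{[2]}`-type `X` with `ρ(X) ≥ 13` and a K3 partner, a rational, type-preserving, `q`-SELF-ADJOINT
endomorphism `Θ` of `H²(X)` with `Θ² = 2` on `T_q(X)` gives `HodgeConjectureFor 4 X` (modulo the nine named
facts): `Θ` preserves `N¹(X)` (Lefschetz `(1,1)`), hence `T_q(X)` by self-adjointness, and
`q(Θ y, Θ w) = q(y, Θ² w) = 2 q(y, w)` there. [cite: Varesco2023, Thm. 2.1 and Thm. 2.9]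
[cite: Markman2024, Thm. 1.1 and 1.4] [cite: VoisinHodgeI2002, Thm. 11.30] -/
theorem hodgeConjectureFor_of_partner_of_selfAdjoint_sqrtTwo_of_thirteen_le
    (hBI : Beauville1983_hilbertSquare_markedIncidence)
    (hBD : Beauville1983_hilbertSquare_blowupDiagonal_surjection)
    (hMk : Markman2024_rationalHodgeIsometry_lift_algebraic_marked)
    (hcup : Voisin2003_cupProduct_algebraicClasses)
    (hB : Buskin2019_hodgeIsometry_algebraic) (hmark : Huybrechts_K3_marking_exists)
    (hPS : Huybrechts_K3_periodSurjective_projective)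
    (hV : Varesco2023_sqrtMultiplication_algebraic_of_symplecticAutomorphism)
    (hGS : VanGeemenSarti2007_nikulinInvolution_of_primitiveE8)
    (hX : IsSmoothProjective 4 X) (hK : IsOfK3HilbertSquareType X) (hM : MarkedK3Sq[X, φ, P, z])
    (hρ : 13 ≤ Module.finrank ℂ ↥(algebraicClasses X 1))
    (hS : IsK3Surface S) (hMS : MarkedK3[S, η, p, x])
    {g : complexBetti S (2 * 1) →ₗ[ℂ] complexBetti X 2} (hg : Partner[X, φ, S, η, g])
    {Θ : complexBetti X 2 →ₗ[ℂ] complexBetti X 2}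
    (hΘrat : ∀ y, IsRationalClass y → IsRationalClass (Θ y))
    (hΘtyp : ∀ (i j : ℕ) y, IsOfHodgeType 4 X 2 i j y → IsOfHodgeType 4 X 2 i j (Θ y))
    (hΘsa : ∀ y w : complexBetti X 2, k3HilbertForm 2 (φ (Θ y)) (φ w) = k3HilbertForm 2 (φ y) (φ (Θ w)))
    (hΘsq : ∀ y : complexBetti X 2,
      (∀ d : complexBetti X 2, d ∈ algebraicClasses X 1 → k3HilbertForm 2 (φ y) (φ d) = 0) →
      Θ (Θ y) = (2 : ℂ) • y) :
    HodgeConjectureFor 4 X := by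
  -- `Θ` preserves `N¹(X)` (Lefschetz `(1,1)`), hence `T_q(X)` (self-adjoint)
  have hΘN : ∀ d ∈ algebraicClasses X 1, Θ d ∈ algebraicClasses X 1 := fun d hd =>
    map_mem_algebraicClasses_of_isRationalClass_of_oneOne hX hX Θ hΘrat (hΘtyp 1 1) hd
  have hΘT : ∀ y : complexBetti X 2,
      (∀ d : complexBetti X 2, d ∈ algebraicClasses X 1 → k3HilbertForm 2 (φ y) (φ d) = 0) →
      ∀ d : complexBetti X 2, d ∈ algebraicClasses X 1 → k3HilbertForm 2 (φ (Θ y)) (φ d) = 0 :=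
    fun y hy d hd => by rw [hΘsa]; exact hy _ (hΘN d hd)
  -- multiplier `2` on `T_q(X)`
  have hΘmul : ∀ y : complexBetti X 2,
      (∀ d : complexBetti X 2, d ∈ algebraicClasses X 1 → k3HilbertForm 2 (φ y) (φ d) = 0) →
      ∀ w : complexBetti X 2,
        (∀ d : complexBetti X 2, d ∈ algebraicClasses X 1 → k3HilbertForm 2 (φ w) (φ d) = 0) →
        k3HilbertForm 2 (φ (Θ y)) (φ (Θ w)) = (2 : ℂ) * k3HilbertForm 2 (φ y) (φ w) := by
    intro y _ w hw
    rw [hΘsa, hΘsq w hw, map_smul, k3HilbertForm_smul_right]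
  exact hodgeConjectureFor_of_partner_of_sqrtTwo_of_thirteen_le hBI hBD hMk hcup hB hmark hPS hV hGS hX hK hM hρ
    hS hMS hg ⟨hΘrat, hΘtyp, hΘT, hΘsq, hΘmul⟩

end Summit.HodgeConjecture.HodgeConjecture.Theorems.MarkmanPartnerTransport.PartnerLattice

end
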